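import Mathlib
import HarnessLib
import Literature.MathematicalPhysics.QuantumLattice.GaugeGroups
import Literature.LinearAlgebra.Matrix.UnitaryGroupMaximalTorus
import Literature.LinearAlgebra.Matrix.SpecialUnitaryGroupConjugacyClasses
import Summits.Ventures.LatticeQCDFlow.Exactness.FlowPushforward
import Summits.Ventures.LatticeQCDFlow.Exactness.KernelJacobianChart
import Summits.Ventures.LatticeQCDFlow.Exactness.CircleGroupJacobian
import Summits.Ventures.LatticeQCDFlow.Exactness.SpectralKernelJacobianWeylShape
import Summits.Ventures.LatticeQCDFlow.Exactness.SpectralKernelJacobianWeylShapeSU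
import Summits.Ventures.LatticeQCDFlow.Scaling.EntropyBudgetCoupling

/-!
# Torus flows in eigen-phase coordinates: Haar on `Δ(n)` / `SΔ(n)` is presented by a product of circles, and `HasJacobian` transports along any measure-presenting intertwiner

HONEST FRAMING: exact (Metropolis-corrected) sampling algorithms for lattice gauge theory;
figures of merit are autocorrelation/cost numbers at stated couplings and volumes; no
continuum-physics claim.

Venture `LatticeQCDFlow` (cell pub-lqcd), topic `Exactness`; FANOUT row 10 (`eng-equiv`, engine
`latflow.equiv` / `latflow.flows_jax`, `spectral.py`: the box flow of the `SU(N)` spectral kernel acts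
on the `N − 1` independent eigen-phases).  NEW WORK of the cell over Mathlib (uniqueness of Haar
measure, `Measure.haarMeasure_unique`; product Haar `Measure.pi`), the tree's
`Literature/LinearAlgebra/Matrix/UnitaryGroupMaximalTorus.lean` (`Δ(n)`, `SΔ(n)`,
`diagonalTorusHom`), row 31's `Theory2.hasJacobian_pointwise` and row 10's
`KernelJacobianChart.withDensity_map_eq_map_withDensity_comp`.  Nothing is cited as a fact; no
number; no definition is introduced (the charts enter through a characterising hypothesis `he` and
an existence theorem).  Printed counterparts, NAMED ONLY: Bröcker–tom Dieck IV (3.1) (the diagonal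
tori are products of circles); Boyda et al., PRD 103 (2021) 074504, App. B Algorithm 2 (the flow acts
on eigen-phases and books a per-phase log-derivative).

The end-to-end exactness theorems for the spectral coupling layer
(`SpectralCouplingLayerExactness[WeylFact].lean`, `SpectralKernelJacobianWeylShape[SU].lean`) take
the TORUS JACOBIAN of the eigenvalue map as the hypothesis
`hfJ : HasJacobian (haarProbability (specialDiagonalTorus n)) fT Jf`.  This file reduces that
hypothesis to a statement about ordinary circle maps:

* **`hasJacobian_of_presentation`** — if `e : X → Ω` is measurable and PRESENTS `vol` from `π`
  (`e_* π = vol`; no injectivity needed), `F'` has Jacobian `J'` for `π`, and `F`, `J` on `Ω` are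
  measurable with `F ∘ e = e ∘ F'`, `J ∘ e = J'`, then `HasJacobian vol F J`;
  `HasJacobian.add`, `HasJacobian.smul` hold the bookkeeping for measures presented in pieces
  (Weyl chambers).
* `U(n)`: for any `e : (n → U(1)) → Δ(n)` with diagonal entries `z i` (`exists_circleChart_diagonalTorus`:
  it exists and is continuous) — `circleChart_diagonalTorus_mul` (a homomorphism),
  `…_bijective_continuous`, **`map_circleChart_pi_haar_diagonalTorus`**
  (`e_* (⊗_i Haar_{U(1)}) = Haar_{Δ(n)}`, uniqueness of Haar measure), and
  **`hasJacobian_diagonalTorus_of_circleChart`** (a torus map read in eigen-phases inherits the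
  Jacobian of its circle-coordinate version); **`hasJacobian_diagonalTorus_pointwise`** —
  independent per-phase circle maps with Jacobians `J_i` give `HasJacobian Haar_{Δ(n)}` with `∏ J_i`.
* `SU(n)` (the engine's group, dependent phase `t_{i₀} = (∏_{i ≠ i₀} t_i)⁻¹`): the sequel
  `SpecialTorusCircleChart.lean`.

NOT here: the engine's simplex/box cell coordinates for `N ≥ 3` (the chart there is the Weyl alcove,
not a product of circles); Weyl's integral formula; any number.
-/

noncomputable section

namespace Summit.Ventures.LatticeQCDFlow.Exactness

open MeasureTheory Matrix Topology
open Literature.LinearAlgebra.Matrix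
open Literature.MathematicalPhysics.QuantumFieldTheory (haarProbability)
open scoped ENNReal

/-! ## `HasJacobian` along a measure-presenting intertwiner -/

section Presentation

variable {X Ω : Type*} [MeasurableSpace X] [MeasurableSpace Ω]

/-- **Transport of a Jacobian along a presentation.**  Let `e : X → Ω` be measurable with
`e_* π = vol`, let `F' : X → X` have Jacobian `J'` for `π`, and let `F`, `J` be measurable on `Ω`
with `F (e x) = e (F' x)` and `J (e x) = J' x`.  Then `F` has Jacobian `J` for `vol`.  (No
injectivity of `e` is needed: `vol·J = e_*(π·J')` because the density is pulled back.) -/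
theorem hasJacobian_of_presentation {π : Measure X} {vol : Measure Ω} {e : X → Ω}
    (he : Measurable e) (hπ : Measure.map e π = vol) {F' : X → X} {J' : X → ℝ≥0∞}
    (hF' : HasJacobian π F' J') {F : Ω → Ω} (hF : Measurable F) {J : Ω → ℝ≥0∞} (hJ : Measurable J)
    (hcomm : ∀ x, F (e x) = e (F' x)) (hJ' : ∀ x, J (e x) = J' x) : HasJacobian vol F J where
  measurable := hF
  measurable_jac := hJ
  map_eq := by
    have hJe : J ∘ e = J' := funext hJ'
    have hFe : F ∘ e = e ∘ F' := funext hcomm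
    rw [← hπ, withDensity_map_eq_map_withDensity_comp he hJ, Measure.map_map hF he, hJe, hFe,
      ← Measure.map_map he hF'.measurable, hF'.map_eq]

/-- Jacobians are stable under adding reference measures. -/
theorem HasJacobian.add {μ ν : Measure Ω} {F : Ω → Ω} {J : Ω → ℝ≥0∞} (hμ : HasJacobian μ F J)
    (hν : HasJacobian ν F J) : HasJacobian (μ + ν) F J where
  measurable := hμ.measurable
  measurable_jac := hμ.measurable_jac
  map_eq := by rw [withDensity_add_measure, Measure.map_add _ _ hμ.measurable, hμ.map_eq, hν.map_eq]

/-- Jacobians are stable under scaling the reference measure. -/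
theorem HasJacobian.smul_measure {μ : Measure Ω} {F : Ω → Ω} {J : Ω → ℝ≥0∞} (hμ : HasJacobian μ F J)
    (c : ℝ≥0∞) : HasJacobian (c • μ) F J where
  measurable := hμ.measurable
  measurable_jac := hμ.measurable_jac
  map_eq := by rw [withDensity_smul_measure, Measure.map_smul, hμ.map_eq]

end Presentation

/-! ## A measurable surjective homomorphism onto a compact group presents its Haar probability -/

section HaarPresentation

variable {X T : Type*} [Group X] [MeasurableSpace X] [MeasurableMul X]
  [Group T] [TopologicalSpace T] [IsTopologicalGroup T] [CompactSpace T] [MeasurableSpace T]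
  [BorelSpace T] [SecondCountableTopology T]

/-- If `e : X → T` is measurable, multiplicative and surjective, `π` is a left-invariant probability
measure on `X` and `T` is a compact second-countable group, then `e_* π` is the Haar probability of
`T` (left invariance is inherited through surjectivity; uniqueness of Haar measure). -/
theorem map_eq_haarProbability_of_mul_of_surjective (π : Measure X) [IsProbabilityMeasure π]
    [π.IsMulLeftInvariant] {e : X → T} (he : Measurable e) (hmul : ∀ x y, e (x * y) = e x * e y)
    (hsurj : Function.Surjective e) : Measure.map e π = haarProbability T := by
  haveI : IsProbabilityMeasure (Measure.map e π) := Measure.isProbabilityMeasure_map he.aemeasurable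
  haveI : (Measure.map e π).IsMulLeftInvariant := by
    refine ⟨fun t => ?_⟩
    obtain ⟨w, rfl⟩ := hsurj t
    rw [Measure.map_map (measurable_const_mul _) he]
    have hcomp : (fun s => e w * s) ∘ e = e ∘ fun x => w * x := by
      funext x
      simp only [Function.comp_apply, hmul]
    rw [hcomp, ← Measure.map_map he (measurable_const_mul w), map_mul_left_eq_self]
  have h := Measure.haarMeasure_unique (Measure.map e π) ⊤
  have h1 : Measure.map e π ((⊤ : TopologicalSpace.PositiveCompacts T) : Set T) = 1 := by
    rw [TopologicalSpace.PositiveCompacts.coe_top]; exact measure_univ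
  rw [h, h1, one_smul]
  rfl

end HaarPresentation

variable {n : Type*} [Fintype n] [DecidableEq n]

/-! ## `U(n)`: the circle chart of `Δ(n)` -/

section Unitary

/-- **The circle chart of `Δ(n)` exists and is continuous**: `z ↦ diag(z)` (the tree's
`diagonalTorusHom`, corestricted). -/
theorem exists_circleChart_diagonalTorus :
    ∃ chart : (n → Circle) → diagonalTorus n, Continuous chart ∧
      ∀ z i, (((chart z : diagonalTorus n) : Matrix.unitaryGroup n ℂ) : Matrix n n ℂ) i i = (z i : ℂ) := by
  obtain ⟨chart, hcont, -, he⟩ := exists_mulEquiv_diagonalTorus n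
  exact ⟨chart, hcont, fun z i => by rw [he z, diagonal_apply_eq]⟩

variable {chart : (n → Circle) → diagonalTorus n}
  (he : ∀ z i, (((chart z : diagonalTorus n) : Matrix.unitaryGroup n ℂ) : Matrix n n ℂ) i i = (z i : ℂ))

include he

/-- The matrix of `chart z` is `diag(z)`. -/
theorem coe_circleChart_diagonalTorus (z : n → Circle) :
    (((chart z : diagonalTorus n) : Matrix.unitaryGroup n ℂ) : Matrix n n ℂ) = diagonal fun i => (z i : ℂ) := by
  rw [coe_diagonalTorus_eq_diagonal (chart z)]
  exact congrArg diagonal (funext fun i => he z i)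

/-- The chart is multiplicative. -/
theorem circleChart_diagonalTorus_mul (z w : n → Circle) : chart (z * w) = chart z * chart w := by
  apply Subtype.ext
  apply Subtype.ext
  change (((chart (z * w) : diagonalTorus n) : Matrix.unitaryGroup n ℂ) : Matrix n n ℂ) =
    (((chart z : diagonalTorus n) : Matrix.unitaryGroup n ℂ) : Matrix n n ℂ) *
      (((chart w : diagonalTorus n) : Matrix.unitaryGroup n ℂ) : Matrix n n ℂ)
  rw [coe_circleChart_diagonalTorus he, coe_circleChart_diagonalTorus he,
    coe_circleChart_diagonalTorus he, diagonal_mul_diagonal]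
  rfl

/-- **The chart is a continuous (hence measurable) bijection** `U(1)ⁿ → Δ(n)`. -/
theorem circleChart_diagonalTorus_bijective_continuous :
    Function.Bijective chart ∧ Continuous chart ∧ Measurable chart := by
  have hinj : Function.Injective chart := by
    intro z w h
    funext i
    apply Circle.ext
    rw [← he z i, ← he w i, h]
  have hsurj : Function.Surjective chart := by
    intro t
    obtain ⟨d, hd⟩ := t.2
    have hd1 : ∀ i, ‖d i‖ = 1 := norm_eq_one_of_mem_diagonalTorus hd
    refine ⟨fun i => ⟨d i, mem_sphere_zero_iff_norm.mpr (hd1 i)⟩, ?_⟩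
    apply Subtype.ext
    apply Subtype.ext
    rw [coe_circleChart_diagonalTorus he, hd]
  have hcont : Continuous chart := by
    refine continuous_induced_rng.2 (continuous_induced_rng.2 ?_)
    have hfun : (fun z => (((chart z : diagonalTorus n) : Matrix.unitaryGroup n ℂ) : Matrix n n ℂ)) =
        fun z => diagonal fun i => (z i : ℂ) := funext fun z => coe_circleChart_diagonalTorus he z
    change Continuous fun z => (((chart z : diagonalTorus n) : Matrix.unitaryGroup n ℂ) : Matrix n n ℂ)
    rw [hfun]
    exact (continuous_pi fun i => continuous_subtype_val.comp (continuous_apply i)).matrix_diagonal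
  exact ⟨⟨hinj, hsurj⟩, hcont, hcont.measurable⟩

/-- **The circle chart presents Haar**: `e_* (⊗_i Haar_{U(1)}) = Haar_{Δ(n)}`. -/
theorem map_circleChart_pi_haar_diagonalTorus :
    Measure.map chart (Measure.pi fun _ : n => haarProbability Circle) = haarProbability (diagonalTorus n) := by
  haveI : SecondCountableTopology (diagonalTorus n) := secondCountableTopology_diagonalTorus
  exact map_eq_haarProbability_of_mul_of_surjective _ (circleChart_diagonalTorus_bijective_continuous he).2.2
    (circleChart_diagonalTorus_mul he) (circleChart_diagonalTorus_bijective_continuous he).1.2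

/-- **Torus maps in eigen-phase coordinates (`U(n)`).**  If `F' : (n → U(1)) → (n → U(1))` has
Jacobian `J'` for `⊗_i Haar_{U(1)}`, and `F`, `J` on `Δ(n)` are measurable with `F (chart z) = chart (F' z)`
and `J (chart z) = J' z`, then `HasJacobian (Haar Δ(n)) F J`. -/
theorem hasJacobian_diagonalTorus_of_circleChart {F' : (n → Circle) → (n → Circle)}
    {J' : (n → Circle) → ℝ≥0∞} (hF' : HasJacobian (Measure.pi fun _ : n => haarProbability Circle) F' J')
    {F : diagonalTorus n → diagonalTorus n} (hF : Measurable F) {J : diagonalTorus n → ℝ≥0∞}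
    (hJ : Measurable J) (hcomm : ∀ z, F (chart z) = chart (F' z)) (hJ' : ∀ z, J (chart z) = J' z) :
    HasJacobian (haarProbability (diagonalTorus n)) F J :=
  hasJacobian_of_presentation (circleChart_diagonalTorus_bijective_continuous he).2.2
    (map_circleChart_pi_haar_diagonalTorus he) hF' hF hJ hcomm hJ'

/-- **Independent per-phase circle maps are exact on `Δ(n)`**: if each `ψ i : U(1) → U(1)` has
Jacobian `J i` (finite) for `Haar_{U(1)}`, and `F`, `Jt` on `Δ(n)` are measurable with
`F (chart z) = chart (fun i => ψ i (z i))`, `Jt (chart z) = ∏ i, J i (z i)`, then `HasJacobian (Haar Δ(n)) F Jt`. -/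
theorem hasJacobian_diagonalTorus_pointwise {ψ : n → Circle → Circle} {J : n → Circle → ℝ≥0∞}
    (hψ : ∀ i, HasJacobian (haarProbability Circle) (ψ i) (J i)) (hJtop : ∀ i x, J i x ≠ ∞)
    {F : diagonalTorus n → diagonalTorus n} (hF : Measurable F) {Jt : diagonalTorus n → ℝ≥0∞}
    (hJt : Measurable Jt) (hcomm : ∀ z, F (chart z) = chart fun i => ψ i (z i))
    (hJ' : ∀ z, Jt (chart z) = ∏ i, J i (z i)) : HasJacobian (haarProbability (diagonalTorus n)) F Jt :=
  hasJacobian_diagonalTorus_of_circleChart he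
    (Theory2.hasJacobian_pointwise (haarProbability Circle) hψ hJtop) hF hJt hcomm hJ'

end Unitary

end Summit.Ventures.LatticeQCDFlow.Exactness
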